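import Summits.QuantumFields.YangMills.Theorems.AtomicCalibrationRSmearedAtomicBoundPieces
import Summits.QuantumFields.YangMills.Theorems.TypicalExteriorCeilingsFactorialCalibration
import HarnessLib

/-!
# E3 part 3/3 — `stub_smearedAtomicBound` PROVED: `AtomCeilings → WhitneyPkg → AtomicSynthesis → AtomicSqrtDominationR → SmearedMomentBound`

* H5 `large_piece_bound`: atomic synthesis (28126) of a LARGE piece (`ρ ≥ a`), slot-wise route atoms, H4 per atom,
  summed absolutely (`Σ|coef| ≤ C₁ⁿ M`);
* H6 `smearedAtomicBound_proof` (= the registered stub BY NAME): near-lattice pieces by H1 (`≤ 256ⁿ(2Cₚ)ⁿ M_j`), large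
  pieces by H5, Whitney/lattice interchange at fixed `a` (H1 majorant, `Summable.tsum_comm`), and
  `c n = α C₂ⁿ (n!)^γ (256ⁿ(2Cₚ)ⁿ + C₁ⁿ (C n^θ √ε)ⁿ) ≤ 2α(1+E)·(C₂(512Cₚ+C₁))ⁿ·(n!)^{γ+1+θ}`
  (`TypicalExteriorCeilings.pow_affine_rpow_le_factorial`).  Proposal flag: `--supports stmt-QuantumFields-28169`.

HONEST LABEL: helper lemmas / a SUPPORT stub (`stub_smearedAtomicBound`, E3) of LINES «AtomicEngine» /
«MirrorCalibration» on support item stmt-QuantumFields-28169 (ideator ym-idea-11 g15; critic idea-crit-9 #85/#86);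
the wall-class items 28126 / 28168 and the open stub E2 enter only as HYPOTHESES; nothing here bears on NT/UV/IR;
no crux / rung / leaf / summit is proved; YM mass gap NOT proved.
-/

set_option autoImplicit false
noncomputable section
open scoped BigOperators
open MeasureTheory Filter Topology
open Literature.MathematicalPhysics.QuantumFieldTheory Literature.MathematicalPhysics.QuantumLattice
open Literature.MathematicalPhysics.AQFT (IsOffDiagonal)
open Literature.Probability.LatticeModels (Site)
open Summit.QuantumFields.YangMills.Cruxes.OSLegsFromFemtoAndGap.DlrCollarTransfer (plane exists_abs_plane_le)
open Summit.QuantumFields.YangMills.Theorems.InfiniteVolume (stateMomentStr)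
open Summit.QuantumFields.YangMills.Theorems.InfVolRP (centreOffset)
open Summit.QuantumFields.YangMills.Theses.OnsetTautology

namespace Summit.QuantumFields.YangMills.Cruxes.AtomicCalibrationR.MirrorCalibration

variable {G : Type} [Group G] [TopologicalSpace G] [IsTopologicalGroup G] [CompactSpace G]
  [MeasurableSpace G] [BorelSpace G]

/-! ## §H5 One LARGE Whitney piece: the atomic series, slot-wise route atoms, E1 + 28168 per atom -/

/-- **H5 `large_piece_bound`.**  For a LARGE piece (`ρ ≥ a`, `ρ ≤ ½`, slots `Λρ`-separated with `Λ ≥ 4t + 12`) written as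
an absolutely convergent atomic series `Gp = Σ_i coef_i ∏_l b(σ_il⁻¹ • (· − η_il))` (`AtomicSynthesis`, 28126) with
`Σ|coef_i| ≤ Mtot`, the lattice-smeared moment obeys `|Σ'_x M_n(x) Gp(z_x)| ≤ Mtot · (C n^θ √ε)ⁿ`.  The interchange of
the lattice sum with the atomic series is justified for FIXED `a` (finite carriers of uniformly bounded size); the
bound is `a`-free. -/
theorem large_piece_bound (hE1 : AtomCeilings) (G₁ : Type) [Group G₁] [TopologicalSpace G₁]
    [IsTopologicalGroup G₁] [CompactSpace G₁] (hG : IsCompactSimpleLieGroup G₁)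
    (hSU : Nonempty (G₁ ≃ₜ* Matrix.specialUnitaryGroup (Fin 2) ℂ)) :
    letI : MeasurableSpace G₁ := borel G₁
    haveI : BorelSpace G₁ := ⟨rfl⟩
    ∀ (r : LatticeRep G₁) (C θ β : ℝ) (μ : Measure (LGConfig 4 G₁)), 0 ≤ C → 0 ≤ β → μ ∈ oddTorusLimitPoints r β →
      SqrtDomClause r μ C θ →
      ∀ (b : SchwartzMap (EuclideanSpace ℝ (Fin 4)) ℝ) (t ε a ρ Λ : ℝ), IsAdmissibleProfile b → 0 ≤ t →
        (∀ u, b u ≠ 0 → ‖u‖ ≤ t) → 0 < ε → 0 < a → (∀ s ∈ onsetSet r μ b ε, s ≤ a) → a ≤ ρ → ρ ≤ 1 / 2 →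
        4 * t + 12 ≤ Λ →
        ∀ (n : ℕ) (q : Fin n → Fin 4 × Fin 4) (c : Fin n → EuclideanSpace ℝ (Fin 4))
          (Gp : (Fin n → EuclideanSpace ℝ (Fin 4)) → ℝ) (coef : ℕ → ℝ) (σ : ℕ → Fin n → ℝ)
          (η : ℕ → Fin n → EuclideanSpace ℝ (Fin 4)) (Mtot : ℝ),
          2 ≤ n → (∀ l, (q l).1 < (q l).2) → (∀ l l', l ≠ l' → ∃ k : Fin 4, Λ * ρ ≤ |c l k - c l' k|) →
          Summable (fun i => |coef i|) → ∑' i, |coef i| ≤ Mtot →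
          (∀ i l, 0 < σ i l ∧ σ i l ≤ ρ ∧ ‖η i l - c l‖ ≤ 2 * ρ) →
          (∀ z, Gp z = ∑' i, coef i * ∏ l, b ((σ i l)⁻¹ • (z l - η i l))) →
          |∑' x : Fin n → Site 4, stateMomentStr G₁ r μ n q x *
              Gp (fun l => a • siteToE (x l) +
                (a / 2) • (EuclideanSpace.single (q l).1 (1 : ℝ) + EuclideanSpace.single (q l).2 (1 : ℝ)))| ≤
            Mtot * (C * n ^ θ * Real.sqrt ε) ^ n := by
  letI : MeasurableSpace G₁ := borel G₁
  haveI : BorelSpace G₁ := ⟨rfl⟩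
  intro r C θ β μ hC hβ hμ h68 b t ε a ρ Λ hb ht hbt hε ha hA hρa hρh hΛ n q c Gp coef σ η Mtot hn hq hsep hcoef
    hMtot hση hGp
  classical
  haveI : IsProbabilityMeasure μ := by
    obtain ⟨S, -, hlim⟩ := hμ
    exact hlim.1
  obtain ⟨Cp, hCp⟩ := exists_abs_plane_le (G := G₁) r
  have hCp0 : 0 ≤ Cp := le_trans (abs_nonneg _) (hCp (0, 1) 0 (fun _ => 1))
  set B : ℝ := ‖b.toBoundedContinuousFunction‖ with hB
  have hB0 : 0 ≤ B := norm_nonneg _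
  set D : ℝ := (C * n ^ θ * Real.sqrt ε) ^ n with hD
  have hD0 : 0 ≤ D := by positivity
  -- weights and carriers of the `i`-th tensor atom
  set w : ℕ → Fin n → (Fin 4 × Fin 4) × (Fin 4 → ℤ) → ℝ := fun i l =>
    atomWt b {q l} (a / σ i l) ((σ i l)⁻¹ • η i l) with hw
  set S : ℕ → Fin n → Finset ((Fin 4 × Fin 4) × (Fin 4 → ℤ)) := fun i l =>
    carrierFinset b (q l) (a / σ i l) t ((σ i l)⁻¹ • η i l) with hSdef
  have hs : ∀ i l, 0 < a / σ i l := fun i l => div_pos ha (hση i l).1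
  have hS : ∀ i l p, w i l p ≠ 0 → p ∈ S i l := fun i l p h => (mem_carrierFinset hbt (hs i l)).2 h
  have hSne : ∀ i l, ∀ p ∈ S i l, w i l p ≠ 0 := fun i l p h => (mem_carrierFinset hbt (hs i l)).1 h
  have hSq : ∀ i l, ∀ p ∈ S i l, p.1 = q l := fun i l p h => fst_eq_of_mem_carrierFinset h
  -- the double family
  set f : ℕ → (Fin n → Site 4) → ℝ := fun i x =>
    coef i * (stateMomentStr G₁ r μ n q x * ∏ l, w i l (q l, x l)) with hf
  -- pointwise: `M(x) · Gp(z_x) = Σ'_i f i x`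
  have hpt : ∀ x : Fin n → Site 4, stateMomentStr G₁ r μ n q x *
      Gp (fun l => a • siteToE (x l) +
        (a / 2) • (EuclideanSpace.single (q l).1 (1 : ℝ) + EuclideanSpace.single (q l).2 (1 : ℝ))) =
      ∑' i, f i x := by
    intro x
    rw [hGp, ← tsum_mul_left]
    refine tsum_congr fun i => ?_
    have : ∏ l, b ((σ i l)⁻¹ • ((fun l => a • siteToE (x l) +
        (a / 2) • (EuclideanSpace.single (q l).1 (1 : ℝ) + EuclideanSpace.single (q l).2 (1 : ℝ))) l - η i l)) =
        ∏ l, w i l (q l, x l) := by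
      refine Finset.prod_congr rfl fun l _ => ?_
      show b ((σ i l)⁻¹ • (a • siteToE (x l) +
        (a / 2) • (EuclideanSpace.single (q l).1 (1 : ℝ) + EuclideanSpace.single (q l).2 (1 : ℝ)) - η i l)) =
        atomWt b {q l} (a / σ i l) ((σ i l)⁻¹ • η i l) (q l, x l)
      exact atom_sample b (hq l) a (σ i l) (η i l) (x l)
    rw [this, hf]
    ring
  -- per atom: the inner lattice sum is 28168's cluster sum, bounded by `D`
  have hAi : ∀ i, |∑' x : Fin n → Site 4, stateMomentStr G₁ r μ n q x * ∏ l, w i l (q l, x l)| ≤ D := by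
    intro i
    rw [tensorAtom_tsum_eq_piFinset r μ q (w i) (S i) (hS i) (hSq i)]
    exact tensorAtom_moment_le hE1 G₁ hG hSU r C θ β μ hβ hμ h68 b t ε a ρ Λ hb ht hbt hε ha hA hρa hΛ n q (σ i)
      (η i) c (S i) hn hq (fun l => ⟨(hση i l).1, (hση i l).2.1, by linarith [(hση i l).2.1]⟩)
      (fun l => (hση i l).2.2) hsep (hS i) (hSne i)
  -- summability of `|f|` on `ℕ × configurations` (fixed `a`: finite carriers of uniformly bounded size)
  set K : ℝ := ((2 * (t * ρ) / a + 4) ^ 4) ^ n with hK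
  have hfin : ∀ i, ∀ x ∉ Fintype.piFinset (fun l => (S i l).image Prod.snd), f i x = 0 := fun i x hx => by
    rw [hf]
    show coef i * (stateMomentStr G₁ r μ n q x * ∏ l, w i l (q l, x l)) = 0
    rw [prod_weight_eq_zero_of_not_mem q (w i) (S i) (hS i) hx, mul_zero, mul_zero]
  have hfi : ∀ i x, |f i x| ≤ |coef i| * ((Cp + Cp) ^ n * B ^ n) := by
    intro i x
    rw [hf]
    show |coef i * (stateMomentStr G₁ r μ n q x * ∏ l, w i l (q l, x l))| ≤ _
    rw [abs_mul, abs_mul, Finset.abs_prod]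
    refine mul_le_mul_of_nonneg_left ?_ (abs_nonneg _)
    refine mul_le_mul
      (Summit.QuantumFields.YangMills.Theorems.InfiniteVolume.abs_stateMomentStr_le r μ hCp q x) ?_
      (Finset.prod_nonneg fun l _ => abs_nonneg _) (by positivity)
    calc ∏ l, |w i l (q l, x l)| ≤ ∏ _l : Fin n, B :=
          Finset.prod_le_prod (fun l _ => abs_nonneg _) (fun l _ => abs_atomWt_le_norm b _ _ _ _)
      _ = B ^ n := by rw [Finset.prod_const, Finset.card_univ, Fintype.card_fin]
  have hcardT : ∀ i, ((Fintype.piFinset (fun l => (S i l).image Prod.snd)).card : ℝ) ≤ K := by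
    intro i
    rw [Fintype.card_piFinset]
    push_cast
    have hslot : ∀ l, (((S i l).image Prod.snd).card : ℝ) ≤ (2 * (t * ρ) / a + 4) ^ 4 := fun l =>
      calc (((S i l).image Prod.snd).card : ℝ) ≤ ((S i l).card : ℝ) := by exact_mod_cast Finset.card_image_le
        _ ≤ (2 * t / (a / σ i l) + 4) ^ 4 := card_carrierFinset_le b (q l) (hs i l) ht _
        _ ≤ (2 * (t * ρ) / a + 4) ^ 4 := by
            have e : 2 * t / (a / σ i l) = 2 * (t * σ i l) / a := by
              rw [div_div_eq_mul_div]; ring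
            rw [e]
            have h0 : 0 ≤ 2 * (t * σ i l) / a + 4 := by
              have := (hση i l).1
              positivity
            have h1 : 2 * (t * σ i l) / a + 4 ≤ 2 * (t * ρ) / a + 4 := by
              gcongr
              exact (hση i l).2.1
            exact pow_le_pow_left₀ h0 h1 4
    calc ∏ l, (((S i l).image Prod.snd).card : ℝ) ≤ ∏ _l : Fin n, (2 * (t * ρ) / a + 4) ^ 4 :=
          Finset.prod_le_prod (fun l _ => by positivity) (fun l _ => hslot l)
      _ = K := by rw [Finset.prod_const, Finset.card_univ, Fintype.card_fin]
  have hinner : ∀ i, Summable (fun x => |f i x|) := fun i =>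
    summable_of_ne_finset_zero (s := Fintype.piFinset (fun l => (S i l).image Prod.snd))
      (fun x hx => by rw [hfin i x hx, abs_zero])
  have hinner_le : ∀ i, ∑' x, |f i x| ≤ |coef i| * ((Cp + Cp) ^ n * B ^ n * K) := by
    intro i
    rw [tsum_eq_sum (s := Fintype.piFinset (fun l => (S i l).image Prod.snd))
      (fun x hx => by rw [hfin i x hx, abs_zero])]
    calc ∑ x ∈ Fintype.piFinset (fun l => (S i l).image Prod.snd), |f i x|
        ≤ ∑ _x ∈ Fintype.piFinset (fun l => (S i l).image Prod.snd), |coef i| * ((Cp + Cp) ^ n * B ^ n) :=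
          Finset.sum_le_sum fun x _ => hfi i x
      _ = (Fintype.piFinset (fun l => (S i l).image Prod.snd)).card * (|coef i| * ((Cp + Cp) ^ n * B ^ n)) := by
          rw [Finset.sum_const, nsmul_eq_mul]
      _ ≤ K * (|coef i| * ((Cp + Cp) ^ n * B ^ n)) :=
          mul_le_mul_of_nonneg_right (hcardT i) (by positivity)
      _ = |coef i| * ((Cp + Cp) ^ n * B ^ n * K) := by ring
  have habs : Summable (fun ix : ℕ × (Fin n → Site 4) => |f ix.1 ix.2|) :=
    (summable_prod_of_nonneg (f := fun ix : ℕ × (Fin n → Site 4) => |f ix.1 ix.2|) (fun ix => abs_nonneg _)).2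
      ⟨hinner, Summable.of_nonneg_of_le (fun i => tsum_nonneg fun x => abs_nonneg _) hinner_le
        (hcoef.mul_right _)⟩
  have hunc : Summable (Function.uncurry f) := (summable_abs_iff (f := Function.uncurry f)).1 habs
  -- interchange and conclude
  rw [tsum_congr hpt, hunc.tsum_comm]
  have hrow : ∀ i, ∑' x, f i x = coef i * ∑' x, stateMomentStr G₁ r μ n q x * ∏ l, w i l (q l, x l) := fun i => by
    rw [hf]
    exact tsum_mul_left
  simp_rw [hrow]
  have hsum2 : Summable fun i => |coef i| * D := hcoef.mul_right D
  have hle : ∀ i, ‖coef i * ∑' x, stateMomentStr G₁ r μ n q x * ∏ l, w i l (q l, x l)‖ ≤ |coef i| * D := fun i => by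
    rw [Real.norm_eq_abs, abs_mul]
    exact mul_le_mul_of_nonneg_left (hAi i) (abs_nonneg _)
  calc |∑' i, coef i * ∑' x, stateMomentStr G₁ r μ n q x * ∏ l, w i l (q l, x l)|
      ≤ ∑' i, |coef i| * D := by
        rw [← Real.norm_eq_abs]
        exact tsum_of_norm_bounded hsum2.hasSum hle
    _ = (∑' i, |coef i|) * D := tsum_mul_right
    _ ≤ Mtot * D := mul_le_mul_of_nonneg_right hMtot hD0

/-! ## §H6 Assembly: the registered stub E3 -/

/-- **E3 `stub_smearedAtomicBound` — PROVED.**  Whitney pieces (E2) are split by radius against the lattice spacing: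
NEAR-LATTICE pieces (`ρ_j < a`) by counting (H1, `≤ 256ⁿ(2Cₚ)ⁿ M_j`), LARGE pieces (`ρ_j ≥ a`) by atomic synthesis
(28126) + E1 ceilings + 28168 (H5, `≤ C₁ⁿ M_j (C n^θ √ε)ⁿ`); the Whitney series is interchanged with the lattice sum at
fixed `a` (H1 majorant, `ρ_j ≤ ½`), and `Σ M_j ≤ α C₂ⁿ (n!)^γ ‖F‖_{Nn}` closes with `c n = α C₂ⁿ (n!)^γ (Xⁿ + C₁ⁿ Dₙ)
≤ 2α(1+E) (C₂(X+C₁))ⁿ (n!)^{γ+1+θ}` (`pow_affine_rpow_le_factorial`). -/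
theorem smearedAtomicBound_proof (hE1 : AtomCeilings) (hW : WhitneyPkg) (hAS : AtomicSynthesis)
    (h68 : AtomicSqrtDominationR) : SmearedMomentBound := by
  intro G₁ _ _ _ _ hG hSU
  letI : MeasurableSpace G₁ := borel G₁
  haveI : BorelSpace G₁ := ⟨rfl⟩
  intro r b ε hb hε
  classical
  -- support radius of the profile
  obtain ⟨t₀, ht₀⟩ :=
    (Metric.isBounded_iff_subset_closedBall (0 : EuclideanSpace ℝ (Fin 4))).1 hb.1.isCompact.isBounded
  set t : ℝ := max t₀ 0 with ht_def
  have ht : 0 ≤ t := le_max_right _ _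
  have hbt : ∀ u, b u ≠ 0 → ‖u‖ ≤ t := fun u hu => by
    have hu' : u ∈ Metric.closedBall (0 : EuclideanSpace ℝ (Fin 4)) t₀ := ht₀ (subset_tsupport _ hu)
    rw [mem_closedBall_zero_iff] at hu'
    exact hu'.trans (le_max_left _ _)
  -- constants of the four inputs
  obtain ⟨C, θ, β₄, hC, hθ, h68'⟩ := sqrtDomClause_of h68 G₁ hG hSU r
  obtain ⟨C₁, N₁, hC₁, hAS'⟩ := hAS b hb.1 hb.2.2.1
  obtain ⟨N, α, C₂, γ, hα, hC₂, hγ, hW'⟩ := hW (4 * t + 12) N₁ (by linarith)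
  obtain ⟨Cp, hCp⟩ := exists_abs_plane_le (G := G₁) r
  have hCp0 : 0 ≤ Cp := le_trans (abs_nonneg _) (hCp (0, 1) 0 (fun _ => 1))
  -- the per-order constant and its factorial calibration
  have hE := fun n : ℕ => Summit.QuantumFields.YangMills.Theorems.TypicalExteriorCeilings.pow_affine_rpow_le_factorial
    (A := 0) (B := C * Real.sqrt ε) (C := 1) (κ := θ) le_rfl (by positivity) zero_le_one hθ n
  refine ⟨fun n => α * C₂ ^ n * (n.factorial : ℝ) ^ γ *
      ((256 * (Cp + Cp)) ^ n + C₁ ^ n * (C * (n : ℝ) ^ θ * Real.sqrt ε) ^ n), N,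
    2 * α * (1 + Real.exp ((0 + C * Real.sqrt ε * 1) * Real.exp θ)), C₂ * (256 * (Cp + Cp) + C₁), γ + (1 + θ),
    max β₄ 0, fun n => ⟨by positivity, ?_⟩, ?_⟩
  · -- `c n ≤ α' C'ⁿ (n!)^γ'`
    have hfac : (0 : ℝ) < n.factorial := by exact_mod_cast n.factorial_pos
    set E : ℝ := Real.exp ((0 + C * Real.sqrt ε * 1) * Real.exp θ) with hE_def
    set X : ℝ := 256 * (Cp + Cp) with hX
    have hX0 : 0 ≤ X := by positivity
    have hD_le : (C * (n : ℝ) ^ θ * Real.sqrt ε) ^ n ≤ E * (n.factorial : ℝ) ^ (1 + θ) := by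
      have e : (0 + C * Real.sqrt ε * (1 * (n : ℝ) ^ θ)) = C * (n : ℝ) ^ θ * Real.sqrt ε := by ring
      have := hE n
      rw [e] at this
      exact this
    have hDn0 : 0 ≤ (C * (n : ℝ) ^ θ * Real.sqrt ε) ^ n := by positivity
    have hE0 : 0 ≤ E := (Real.exp_pos _).le
    have h1 : X ^ n ≤ (X + C₁) ^ n := pow_le_pow_left₀ hX0 (by linarith) n
    have h2 : C₁ ^ n ≤ (X + C₁) ^ n := pow_le_pow_left₀ hC₁ (by linarith) n
    have h3 : 1 ≤ (n.factorial : ℝ) ^ (1 + θ) :=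
      Real.one_le_rpow (by exact_mod_cast Nat.one_le_of_lt n.factorial_pos) (by positivity)
    have hXC0 : 0 ≤ (X + C₁) ^ n := by positivity
    have hQ_le : X ^ n + C₁ ^ n * (C * (n : ℝ) ^ θ * Real.sqrt ε) ^ n ≤
        2 * (1 + E) * (X + C₁) ^ n * (n.factorial : ℝ) ^ (1 + θ) := by
      have s1 : X ^ n ≤ (X + C₁) ^ n * (n.factorial : ℝ) ^ (1 + θ) := by
        calc X ^ n ≤ (X + C₁) ^ n := h1
          _ = (X + C₁) ^ n * 1 := (mul_one _).symm
          _ ≤ (X + C₁) ^ n * (n.factorial : ℝ) ^ (1 + θ) := mul_le_mul_of_nonneg_left h3 hXC0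
      have s2 : C₁ ^ n * (C * (n : ℝ) ^ θ * Real.sqrt ε) ^ n ≤ (X + C₁) ^ n * (E * (n.factorial : ℝ) ^ (1 + θ)) :=
        mul_le_mul h2 hD_le hDn0 hXC0
      have s3 : (X + C₁) ^ n * (n.factorial : ℝ) ^ (1 + θ) + (X + C₁) ^ n * (E * (n.factorial : ℝ) ^ (1 + θ)) =
          (1 + E) * (X + C₁) ^ n * (n.factorial : ℝ) ^ (1 + θ) := by ring
      have s4 : (1 + E) * (X + C₁) ^ n * (n.factorial : ℝ) ^ (1 + θ) ≤
          2 * (1 + E) * (X + C₁) ^ n * (n.factorial : ℝ) ^ (1 + θ) := by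
        have : 0 ≤ (1 + E) * (X + C₁) ^ n * (n.factorial : ℝ) ^ (1 + θ) := by positivity
        linarith
      linarith
    calc α * C₂ ^ n * (n.factorial : ℝ) ^ γ * (X ^ n + C₁ ^ n * (C * (n : ℝ) ^ θ * Real.sqrt ε) ^ n)
        ≤ α * C₂ ^ n * (n.factorial : ℝ) ^ γ * (2 * (1 + E) * (X + C₁) ^ n * (n.factorial : ℝ) ^ (1 + θ)) :=
          mul_le_mul_of_nonneg_left hQ_le (by positivity)
      _ = 2 * α * (1 + E) * (C₂ * (X + C₁)) ^ n * (n.factorial : ℝ) ^ (γ + (1 + θ)) := by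
          rw [show (n.factorial : ℝ) ^ (γ + (1 + θ)) = (n.factorial : ℝ) ^ γ * (n.factorial : ℝ) ^ (1 + θ) from
            Real.rpow_add hfac γ (1 + θ), mul_pow]
          ring
  · -- the bound itself
    intro β hβ μ hμ a ha ha1 hA n q hn hq F hF
    have hβ0 : 0 ≤ β := le_trans (le_max_right _ _) hβ
    have hβ4 : β₄ ≤ β := le_trans (le_max_left _ _) hβ
    have h68μ : SqrtDomClause r μ C θ := h68' β hβ4 μ hμ
    haveI : IsProbabilityMeasure μ := by
      obtain ⟨S, -, hlim⟩ := hμ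
      exact hlim.1
    have hn1 : 1 ≤ n := by omega
    obtain ⟨κ, Gp, cp, ρ, M, hκ, hρ, hsupp, hsepW, hderiv, hM0, hMsum, hMle, hHas⟩ := hW' n hn1 F hF
    set X : ℝ := 256 * (Cp + Cp) with hX
    set Dn : ℝ := (C * (n : ℝ) ^ θ * Real.sqrt ε) ^ n with hDn
    have hDn0 : 0 ≤ Dn := by positivity
    set Qn : ℝ := X ^ n + C₁ ^ n * Dn with hQn
    have hQ0 : 0 ≤ Qn := by positivity
    -- sup bounds and supports of the pieces
    have hGsup : ∀ j z, |Gp j z| ≤ M j := fun j z => by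
      have h0 := hderiv j 0 (Nat.zero_le _) z
      rw [norm_iteratedFDeriv_zero, pow_zero, div_one, Real.norm_eq_abs] at h0
      exact h0
    have hGsupp : ∀ j z, Gp j z ≠ 0 → ∀ l, ‖z l - cp j l‖ ≤ ρ j := fun j z hz => hsupp j (subset_tsupport _ hz)
    -- per-piece real lattice sums and their bound `|A j| ≤ M j · Qn`
    set A : ℕ → ℝ := fun j => ∑' x : Fin n → Site 4, stateMomentStr G₁ r μ n q x * Gp j (samplePt a q x)
      with hA_def
    have hAj : ∀ j, |A j| ≤ M j * Qn := by
      intro j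
      rcases lt_or_ge (ρ j) a with hnear | hfar
      · -- near-lattice piece: counting
        have hb3 := (piece_tsum_bound r μ hCp q hq ha (hρ j).1.le (cp j) (Gp j) (hGsup j) (hGsupp j)).2.2
        have hρj := (hρ j).1
        have hcount : ((2 * ρ j / a + 2) ^ 4) ^ n ≤ (256 : ℝ) ^ n := by
          apply pow_le_pow_left₀ (by positivity)
          have h2 : 2 * ρ j / a ≤ 2 := by
            rw [div_le_iff₀ ha]
            linarith
          calc (2 * ρ j / a + 2) ^ 4 ≤ (4 : ℝ) ^ 4 := pow_le_pow_left₀ (by positivity) (by linarith) 4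
            _ = 256 := by norm_num
        have hMj := hM0 j
        calc |A j| ≤ ((2 * ρ j / a + 2) ^ 4) ^ n * ((Cp + Cp) ^ n * M j) := hb3
          _ ≤ 256 ^ n * ((Cp + Cp) ^ n * M j) := mul_le_mul_of_nonneg_right hcount (by positivity)
          _ = M j * X ^ n := by rw [hX, mul_pow]; ring
          _ ≤ M j * Qn := mul_le_mul_of_nonneg_left (le_add_of_nonneg_right (by positivity)) hMj
      · -- large piece: atomic synthesis + E1 + 28168
        obtain ⟨coef, σ, η, hsum, hle, hση, hrepr⟩ :=
          hAS' n hn1 (Gp j) (cp j) (ρ j) (M j) (hρ j).1 (hsupp j) (fun m hm z => hderiv j m hm z)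
        have hb5 := large_piece_bound hE1 G₁ hG hSU r C θ β μ hC hβ0 hμ h68μ b t ε a (ρ j) (4 * t + 12) hb ht
          hbt hε ha hA hfar (hρ j).2 le_rfl n q (cp j) (Gp j) coef σ η (C₁ ^ n * M j) hn hq (hsepW j) hsum hle
          hση hrepr
        have hMj := hM0 j
        calc |A j| ≤ C₁ ^ n * M j * (C * (n : ℝ) ^ θ * Real.sqrt ε) ^ n := hb5
          _ = M j * (C₁ ^ n * Dn) := by rw [hDn]; ring
          _ ≤ M j * Qn := mul_le_mul_of_nonneg_left (le_add_of_nonneg_left (by positivity)) hMj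
    -- the complex double family `(j, x) ↦ κ_j M_n(x) G_j(z_x)` and its summability (fixed `a`)
    set fC : ℕ → (Fin n → Site 4) → ℂ := fun j x =>
      κ j * (((stateMomentStr G₁ r μ n q x * Gp j (samplePt a q x) : ℝ)) : ℂ) with hfC
    have hmaj : ∀ j x, ‖fC j x‖ ≤ |stateMomentStr G₁ r μ n q x * Gp j (samplePt a q x)| := fun j x => by
      rw [hfC]
      dsimp only
      rw [norm_mul, Complex.norm_real, Real.norm_eq_abs]
      exact mul_le_of_le_one_left (abs_nonneg _) (hκ j)
    have hK : ∀ j, ∑' x : Fin n → Site 4, |stateMomentStr G₁ r μ n q x * Gp j (samplePt a q x)| ≤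
        ((1 / a + 2) ^ 4) ^ n * ((Cp + Cp) ^ n * M j) := by
      intro j
      refine (piece_tsum_bound r μ hCp q hq ha (hρ j).1.le (cp j) (Gp j) (hGsup j) (hGsupp j)).2.1.trans ?_
      have hMj := hM0 j
      refine mul_le_mul_of_nonneg_right ?_ (by positivity)
      apply pow_le_pow_left₀ (by positivity)
      apply pow_le_pow_left₀ (have := (hρ j).1; by positivity)
      have : 2 * ρ j / a ≤ 1 / a := div_le_div_of_nonneg_right (by linarith [(hρ j).2]) ha.le
      linarith
    have hmajsum : Summable (fun jx : ℕ × (Fin n → Site 4) =>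
        |stateMomentStr G₁ r μ n q jx.2 * Gp jx.1 (samplePt a q jx.2)|) := by
      refine (summable_prod_of_nonneg (fun jx => abs_nonneg _)).2 ⟨fun j =>
        (piece_tsum_bound r μ hCp q hq ha (hρ j).1.le (cp j) (Gp j) (hGsup j) (hGsupp j)).1, ?_⟩
      refine Summable.of_nonneg_of_le (fun j => tsum_nonneg fun x => abs_nonneg _) hK ?_
      exact (hMsum.mul_left ((Cp + Cp) ^ n)).mul_left (((1 / a + 2) ^ 4) ^ n)
    have hunc : Summable (Function.uncurry fC) :=
      Summable.of_norm_bounded hmajsum (fun jx => hmaj jx.1 jx.2)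
    -- rewrite the functional as the interchanged double sum
    have hpt : ∀ x : Fin n → Site 4,
        ((stateMomentStr G₁ r μ n q x : ℝ) : ℂ) * F (samplePt a q x) = ∑' j, fC j x := by
      intro x
      rw [← (hHas (samplePt a q x)).tsum_eq, ← tsum_mul_left]
      refine tsum_congr fun j => ?_
      rw [hfC]
      push_cast
      ring
    have hrow : ∀ j, ∑' x, fC j x = κ j * ((A j : ℝ) : ℂ) := fun j => by
      rw [hfC, hA_def]
      dsimp only
      rw [tsum_mul_left, Complex.ofReal_tsum]
    change ‖∑' x : Fin n → Site 4, ((stateMomentStr G₁ r μ n q x : ℝ) : ℂ) * F (samplePt a q x)‖ ≤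
      α * C₂ ^ n * (n.factorial : ℝ) ^ γ * (X ^ n + C₁ ^ n * Dn) * schwartzNorm (N * n) F
    rw [tsum_congr hpt, hunc.tsum_comm]
    simp_rw [hrow]
    have hle : ∀ j, ‖κ j * ((A j : ℝ) : ℂ)‖ ≤ M j * Qn := fun j => by
      rw [norm_mul, Complex.norm_real, Real.norm_eq_abs]
      calc ‖κ j‖ * |A j| ≤ 1 * |A j| := mul_le_mul_of_nonneg_right (hκ j) (abs_nonneg _)
        _ = |A j| := one_mul _
        _ ≤ M j * Qn := hAj j
    have hsumMQ : Summable fun j => M j * Qn := hMsum.mul_right _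
    calc ‖∑' j, κ j * ((A j : ℝ) : ℂ)‖ ≤ ∑' j, M j * Qn := tsum_of_norm_bounded hsumMQ.hasSum hle
      _ = (∑' j, M j) * Qn := tsum_mul_right
      _ ≤ α * C₂ ^ n * (n.factorial : ℝ) ^ γ * schwartzNorm (N * n) F * Qn :=
          mul_le_mul_of_nonneg_right hMle hQ0
      _ = α * C₂ ^ n * (n.factorial : ℝ) ^ γ * (X ^ n + C₁ ^ n * Dn) * schwartzNorm (N * n) F := by
          rw [hQn]; ring

/-- The registered stub E3, by name. -/
theorem stub_smearedAtomicBound :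
    AtomCeilings → WhitneyPkg → AtomicSynthesis → AtomicSqrtDominationR → SmearedMomentBound :=
  smearedAtomicBound_proof

end Summit.QuantumFields.YangMills.Cruxes.AtomicCalibrationR.MirrorCalibration
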